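import Literature.NumberTheory.Weil1964.ArchFollandTorusAdelic
import Literature.NumberTheory.Weil1964.ArchFollandCocycleOne
import Literature.Analysis.SegalBargmann.SchwartzTorusIdentification
import HarnessLib

/-!
# Hermite functions of the adapted Folland frame are weight vectors of every archimedean torus implementer (the `κ`-sign, STEP 3 (b)+(c))

Topic `NumberTheory/Weil1964`; namespace `Literature.NumberTheory.Weil1964`.  Definitions and proved lemmas only:
**no named facts, no records, 0 proof holes, 0 cited hypotheses**.

**Setting and purpose.**  STEP 1 (`ArchFollandTorus`) computed the compact diagonal torus `diag(e^{iθ_j})` of a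
unitary group at a real place in the ADAPTED Folland scaling: it is the rotation `realify (diagHom (torusPt (ε · θ)))`
with the sign vector `ε_j = sgn(im δ' · σ(t₀ j))` (the opposite sign is refused by the kernel).  STEP 2
(`ArchFollandTorusAdelic`) transported this to the adelic Folland coordinates `archFolland T e_D` in the scaled
real-place frame `e_D = scaledFrame D` (`archFolland_archAct_torus`, `archPhaseMap_torus`), and LEAF C
(`ArchFollandCocycleOne`) proved that the archimedean tensor factor `A` of any implementer `M = A ⊗ M_f` of
`g ∈ Sp(W_𝔸)` is EXACTLY `rhoSD e`-covariant over `archPhaseMap T e g` (`arch_covariant_rhoSD_exact`: the Folland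
cocycle is `1`).  The present file draws the Fock-side consequence through the rigidity lane
(`SegalBargmann.SchwartzTorusIdentification`: a Schwartz-level family that is Heisenberg-covariant over a torus
rotation and lifts to unitaries IS `e^{iθ·N}` up to its vacuum coefficient):

* §1 (generic carrier `D`, frame `e : D ≃L[ℝ] ℝ^σ`) **`follandHermite e β := (e^*)⁻¹ h_β`**, the Hermite functions
  of the frame on `𝓢(D, ℂ)` (`follandHermite e β y = h_β (e y)`); `vacCoeffU U = ⟪k₀, U k₀⟫`; the SINGLE-OPERATOR
  torus rigidity **`apply_eq_vacCoeffU_smul_of_torusCovariant`**: an operator `A` of `𝓢(D)` exactly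
  `rhoSD e`-covariant over `realify (diagHom (torusPt φ))` whose transport `e^* A (e^*)⁻¹` is the restriction of a
  unitary `U` of `L²(ℝ^σ)` is `⟪k₀, U k₀⟫ · (e^*)⁻¹ e^{iφ·N} e^*` on ALL of `𝓢(D)`, `‖⟪k₀, U k₀⟫‖ = 1`
  (`norm_vacCoeffU_of_torusCovariant`), hence **`apply_follandHermite_of_torusCovariant`**:
  `A (follandHermite e β) = (⟪k₀, U k₀⟫ · e^{iφ·β}) • follandHermite e β`; and the FAMILY forms
  (`family_apply_follandHermite`, `family_apply_eq_vacCoeff_smul`, `family_isRhoCovariant_lift`) — the currency of a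
  weight-space statement: every `follandHermite e β` is a simultaneous weight vector of a covariant family `k ↦ A k`
  with weight `k ↦ vacCoeff U k · e^{iφ(k)·β}`, `vacCoeff` the unitary vacuum character of the rigidity lane.
* §2 (archimedean, `F` totally real, `T = diag(t₀) ⊗ 1`, hypotheses of `archPhaseMap_torus` VERBATIM — in particular
  STEP 2's place-by-place torus hypothesis `hg` is KEPT AS A HYPOTHESIS; it is discharged for the cell's adelic
  embedding of record by the separate leaf `ArchActQuadraticPlaces`) **`arch_torus_covariant_rhoSD`** (exact
  covariance of the archimedean factor over `realify (diagHom (torusPt (ε · θ)))`),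
  **`arch_torus_apply_eq_vacCoeffU_smul`** (`A = ⟪k₀, U k₀⟫ · (e_D^*)⁻¹ e^{i(ε·θ)·N} e_D^*` on all of
  `𝓢((ι → F ⊗ ℝ), ℂ)`), `arch_torus_norm_vacCoeffU`, and the main statement
  **`arch_torus_apply_follandHermite`**:
  `A (follandHermite e_D β) = (⟪k₀, U k₀⟫ · exp(i Σ_{(j,v)} ε_{j,v} θ_{j,v} β_{j,v})) • follandHermite e_D β` —
  the Hermite functions of the ADAPTED Folland frame are weight vectors of every archimedean torus implementer,
  with torus weight the SIGNED index `ε · β` times the vacuum coefficient (`torusPhase_signed` spells the phase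
  out; `arch_torus_apply_follandHermite_sqrt` is the canonical scaling `D = √(|σ(t₀)| / |im δ'|)`,
  `ε = sgn(im δ' · σ(t₀))`).
* §3 the same in the currency of a CM-type quadratic extension `E/F` (`archLocalToSymplectic` at the complex place
  `wOf v` over `v`, `c δ = −δ ≠ 0`, `J = diag(t₀) ⊗ 1`): `archPhaseMap_archLocalTorus` (STEP 2's
  `archFolland_archAct_archLocalTorus` as an identity of phase-space maps) and **`archCM_torus_apply_follandHermite`**
  with `ε_{j,v} = sgn(im σ_{w(v)}(δ) · σ_{w(v)}(t₀ j))`: the Hermite degree in the `(j, v)` direction enters the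
  weight with `+θ_{j,v}` exactly when `im σ_{w(v)}(δ) · σ_{w(v)}(t₀ j) > 0`.

**NOT in this leaf** (booking (UU′) 2026-08-19; it stays with the binder-2 successor / the RUN-34 census): STEP 3 (d),
the comparison of the weight `vacCoeff · e^{i(ε·θ)·β}` on the PRINTED Hermite index with the isotropy character
`archKappa` (`UnitaryGroupArchIsotropy`; weight `(1,1;−2)` by `UnitBallIsotropyTorusWeights.Jac_diagU_x₀`) and the
census-time membership `kappaIsotypic ρ e archKappa ∋ ins f φ_print`; this file hands it the weight formula by name.
Also not here: the VALUE of the vacuum coefficient `k ↦ ⟪k₀, U_k k₀⟩` (a unitary character of the torus when the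
lifts form a representation, `family_isRhoCovariant_lift` + `SchrodingerCompactRigidity.vacChar`), which depends on
the chosen archimedean splitting and is read from the printed records elsewhere in the cell.

Dictionary with print: Folland [Folland1989] §1.7 (the Hermite functions `h_β`, (1.81), are the joint
eigenfunctions of the oscillator torus `e^{iθ·N}`), §4.2 (4.23)–(4.24) with the Schur remark p. 156 (an operator
intertwining `ρ(p,q)` with `ρ(S(p,q))` is unique up to a unimodular scalar) and Prop. (4.39) (the metaplectic
representation restricted to `U(n) = Sp ∩ O(2n)` is computed on the torus; it fixes the Gaussian up to a character),
Ch. 4 §1 Prop. (4.6) (`U(n)` inside `Sp`); Prop. (1.43) (linear changes of polarisation).  The present file is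
bookkeeping around these tree theorems — no analysis beyond the imported lanes.

## Mathlib / tree

Mathlib: `ContinuousLinearEquiv.apply_symm_apply`, `symm_apply_apply`, `map_smul`, `LinearIsometryEquiv`.
Tree: `SegalBargmann.schwartzTransport`, `opTransport` (`opTransport_apply`), `rhoSD`, `IsRhoCovariantS`,
`isRhoCovariantS_opTransport_iff`, `IsRhoCovariantS.apply_eq_vacCoeff_smul_torusOpPi`, `IsRhoCovariantS.apply_hermitePi`,
`IsRhoCovariantS.lift`, `IsRhoCovariant.norm_vacCoeff`, `vacCoeff`, `liftCLM`, `LiftsTo`, `hermitePi`, `torusOpPi`,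
`torusOpPi_hermitePi`, `torusPhase`, `torusPt`, `diagHom`, `realify`; `Weil1964.arch_covariant_rhoSD_exact`,
`archPhaseMap_torus`, `archFolland_archAct_archLocalTorus`, `archFolland_bijective`, `archPhaseMap_archFolland`,
`scaledFrame`, `placeVec`, `sqrt_scale_ne_zero`, `sqrt_scale_ne_zero_CM`, `adapted_sqrt`, `sign_eq_one_or`,
`im_ne_zero_of_isQuadraticCoordinates`, `torusGL`, `UnitaryGroup.IsQuadraticCoordinates.resAut`,
`UnitaryGroup.archLocalToSymplectic`, `UnitaryGroup.realPlaceMap`.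

## References

* [Folland1989] G. B. Folland, *Harmonic Analysis in Phase Space*, Annals of Mathematics Studies 122, Princeton
  University Press (1989): §1.7 (1.81); Prop. (1.43); §4.2 (4.23)–(4.24) and the Schur remark p. 156; Prop. (4.39);
  Ch. 4 §1, Prop. (4.6) p. 151 (doi:10.1515/9781400882427).
* [Weil1964] A. Weil, *Sur certains groupes d'opérateurs unitaires*, Acta Math. 111 (1964), n° 4–5.

## Provenance

Written under the LEAN-IN-TREE rule (2026-08-18) for the pub-hodgecm formalisation cell (HAZARD γ-K (b) / D5-arch, the
archimedean `κ`-sign, STEP 3 (b)+(c) of the binder-2 lane's hand-off list, booked (UU′) 2026-08-19 to the mc-weil-1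
lane, gen 2).  KERNEL only — nothing here is a claim of the sources beyond the cited dictionary; all statements are
proved.
-/

set_option autoImplicit false

noncomputable section

open scoped Matrix SchwartzMap TensorProduct Real Classical InnerProductSpace
open MeasureTheory Complex NumberField NumberField.InfinitePlace NumberField.mixedEmbedding IsDedekindDomain
open Literature.NumberTheory.Automorphic Literature.NumberTheory.Automorphic.UnitaryGroup
open Literature.RepresentationTheory.HeisenbergGroup Literature.Analysis.SegalBargmann

namespace Literature.NumberTheory.Weil1964

/-! ## §1 Single-operator torus rigidity on `𝓢(D, ℂ)` along a Folland frame `e : D ≃L[ℝ] ℝ^σ` -/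

section Generic

variable {σ : Type*} [Fintype σ] [DecidableEq σ]
variable {D : Type*} [NormedAddCommGroup D] [NormedSpace ℝ D]

local notation "L2R" σ => Lp ℂ 2 (volume : Measure (σ → ℝ))
local notation "SR" σ => SchwartzMap (σ → ℝ) ℂ

/-- **The Hermite functions of the Folland frame `e` on `𝓢(D, ℂ)`**: `follandHermite e β := (e^*)⁻¹ h_β`, i.e.
`follandHermite e β y = h_β (e y)` with `h_β = hermitePi β` the Hermite functions of `𝓢(ℝ^σ, ℂ)`.
[cite: Folland1989, §1.7 (1.81)] -/
def follandHermite (e : D ≃L[ℝ] (σ → ℝ)) (β : σ →₀ ℕ) : 𝓢(D, ℂ) := (schwartzTransport e).symm (hermitePi β)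

/-- `e^* (follandHermite e β) = h_β`. [folklore] -/
@[simp] theorem schwartzTransport_follandHermite (e : D ≃L[ℝ] (σ → ℝ)) (β : σ →₀ ℕ) :
    schwartzTransport e (follandHermite e β) = hermitePi β :=
  (schwartzTransport e).apply_symm_apply _

/-- Pointwise: `follandHermite e β y = h_β (e y)`. [folklore] -/
theorem follandHermite_apply (e : D ≃L[ℝ] (σ → ℝ)) (β : σ →₀ ℕ) (y : D) :
    follandHermite e β y = hermitePi β (e y) := rfl

/-- The **vacuum coefficient of a unitary operator `U` of `L²(ℝ^σ)`**: `⟪k₀, U k₀⟫`, `k₀ = vacL2` the class of the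
Gaussian (it is `vacCoeff` of the rigidity lane for the one-member family `U`). [cite: Folland1989, Prop. (4.39)] -/
def vacCoeffU (U : (L2R σ) ≃ₗᵢ[ℂ] L2R σ) : ℂ := ⟪(vacL2 : L2R σ), U vacL2⟫_ℂ

omit [DecidableEq σ] in
/-- `vacCoeffU U = vacCoeff (fun _ : Unit => U) ()`. [folklore] -/
theorem vacCoeffU_eq_vacCoeff (U : (L2R σ) ≃ₗᵢ[ℂ] L2R σ) :
    vacCoeffU U = vacCoeff (fun _ : Unit => U) () := rfl

/-- A single operator exactly `rhoSD e`-covariant over the torus rotation `realify (diagHom (torusPt φ))`, whose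
transport `e^* A (e^*)⁻¹` lifts to the unitary `U` of `L²(ℝ^σ)`, IS a one-member covariant family of the rigidity
lane (index type `Unit`). [folklore] -/
theorem isRhoCovariantS_punit_of_torusCovariant (e : D ≃L[ℝ] (σ → ℝ)) {A : 𝓢(D, ℂ) →ₗ[ℂ] 𝓢(D, ℂ)} {φ : σ → ℝ}
    (hA : ∀ (p q : σ → ℝ) (f : 𝓢(D, ℂ)), A (rhoSD e p q f) =
      rhoSD e (realify (diagHom (torusPt φ)) (p, q)).1 (realify (diagHom (torusPt φ)) (p, q)).2 (A f)) :
    IsRhoCovariantS (fun _ : Unit => diagHom (torusPt φ)) (fun _ : Unit => opTransport e A) :=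
  (isRhoCovariantS_opTransport_iff e _ (fun _ : Unit => A)).2 (fun _ p q f => hA p q f)

/-- **Single-operator torus rigidity on `𝓢(D, ℂ)`.**  Let `A : 𝓢(D) →ₗ 𝓢(D)` be EXACTLY `rhoSD e`-covariant over
the torus rotation `realify (diagHom (torusPt φ))` of phase space (`torusPt φ = (e^{−iφ_l})_l`), and let its transport
`e^* A (e^*)⁻¹` be the restriction of a unitary operator `U` of `L²(ℝ^σ)`.  Then on ALL of `𝓢(D)`
`A = ⟪k₀, U k₀⟫ · (e^*)⁻¹ ∘ e^{iφ·N} ∘ e^*`. [cite: Folland1989, Prop (4.39)] -/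
theorem apply_eq_vacCoeffU_smul_of_torusCovariant (e : D ≃L[ℝ] (σ → ℝ)) {A : 𝓢(D, ℂ) →ₗ[ℂ] 𝓢(D, ℂ)}
    {φ : σ → ℝ}
    (hA : ∀ (p q : σ → ℝ) (f : 𝓢(D, ℂ)), A (rhoSD e p q f) =
      rhoSD e (realify (diagHom (torusPt φ)) (p, q)).1 (realify (diagHom (torusPt φ)) (p, q)).2 (A f))
    (U : (L2R σ) ≃ₗᵢ[ℂ] L2R σ)
    (hU : LiftsTo (opTransport e A)
      ((U.toContinuousLinearEquiv : (L2R σ) ≃L[ℂ] L2R σ) : (L2R σ) →L[ℂ] L2R σ))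
    (f : 𝓢(D, ℂ)) :
    A f = vacCoeffU U • (schwartzTransport e).symm (torusOpPi φ (schwartzTransport e f)) := by
  have hS := isRhoCovariantS_punit_of_torusCovariant e hA
  have hlift : ∀ h : Unit, LiftsTo ((fun _ : Unit => opTransport e A) h) (liftCLM (fun _ : Unit => U) h) :=
    fun _ => hU
  have h1 := hS.apply_eq_vacCoeff_smul_torusOpPi hlift (h := ()) (θ := φ) rfl (schwartzTransport e f)
  simp only [opTransport_apply, ContinuousLinearEquiv.symm_apply_apply] at h1
  apply (schwartzTransport e).injective
  rw [h1, map_smul, ContinuousLinearEquiv.apply_symm_apply, vacCoeffU_eq_vacCoeff]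

/-- … and the scalar is unimodular: `‖⟪k₀, U k₀⟫‖ = 1`. [cite: Folland1989, Prop (4.39)] -/
theorem norm_vacCoeffU_of_torusCovariant (e : D ≃L[ℝ] (σ → ℝ)) {A : 𝓢(D, ℂ) →ₗ[ℂ] 𝓢(D, ℂ)} {φ : σ → ℝ}
    (hA : ∀ (p q : σ → ℝ) (f : 𝓢(D, ℂ)), A (rhoSD e p q f) =
      rhoSD e (realify (diagHom (torusPt φ)) (p, q)).1 (realify (diagHom (torusPt φ)) (p, q)).2 (A f))
    (U : (L2R σ) ≃ₗᵢ[ℂ] L2R σ)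
    (hU : LiftsTo (opTransport e A)
      ((U.toContinuousLinearEquiv : (L2R σ) ≃L[ℂ] L2R σ) : (L2R σ) →L[ℂ] L2R σ)) :
    ‖vacCoeffU U‖ = 1 := by
  have hS := isRhoCovariantS_punit_of_torusCovariant e hA
  have hlift : ∀ h : Unit, LiftsTo ((fun _ : Unit => opTransport e A) h) (liftCLM (fun _ : Unit => U) h) :=
    fun _ => hU
  rw [vacCoeffU_eq_vacCoeff]
  exact (hS.lift hlift).norm_vacCoeff ()

/-- **The Hermite functions of the frame are weight vectors**: under the hypotheses of
`apply_eq_vacCoeffU_smul_of_torusCovariant`, `A (follandHermite e β) = (⟪k₀, U k₀⟫ · e^{iφ·β}) • follandHermite e β`.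
[cite: Folland1989, §1.7] -/
theorem apply_follandHermite_of_torusCovariant (e : D ≃L[ℝ] (σ → ℝ)) {A : 𝓢(D, ℂ) →ₗ[ℂ] 𝓢(D, ℂ)} {φ : σ → ℝ}
    (hA : ∀ (p q : σ → ℝ) (f : 𝓢(D, ℂ)), A (rhoSD e p q f) =
      rhoSD e (realify (diagHom (torusPt φ)) (p, q)).1 (realify (diagHom (torusPt φ)) (p, q)).2 (A f))
    (U : (L2R σ) ≃ₗᵢ[ℂ] L2R σ)
    (hU : LiftsTo (opTransport e A)
      ((U.toContinuousLinearEquiv : (L2R σ) ≃L[ℂ] L2R σ) : (L2R σ) →L[ℂ] L2R σ))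
    (β : σ →₀ ℕ) :
    A (follandHermite e β) = (vacCoeffU U * torusPhase φ β) • follandHermite e β := by
  rw [apply_eq_vacCoeffU_smul_of_torusCovariant e hA U hU, schwartzTransport_follandHermite, torusOpPi_hermitePi,
    map_smul, smul_smul]
  rfl


/-- **Family form** (the currency of an isotypic / weight-space statement): let `k ↦ A k` be a family of operators
of `𝓢(D)` indexed by any type `H`, each exactly `rhoSD e`-covariant over the rotation `realify (diagHom (torusPt (φ k)))`
and with transports lifting to unitaries `U k` of `L²(ℝ^σ)`.  Then every `follandHermite e β` is a SIMULTANEOUS weight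
vector: `A k (follandHermite e β) = (vacCoeff U k · e^{iφ(k)·β}) • follandHermite e β`; when `H` is a group and `U` is
multiplicative, `k ↦ vacCoeff U k` is the unitary character `vacChar` of the rigidity lane
(`SchrodingerCompactRigidity.vacChar`), so the weight is the character `k ↦ vacChar k · e^{iφ(k)·β}`.
[cite: Folland1989, §1.7, Prop (4.39)] -/
theorem family_apply_follandHermite (e : D ≃L[ℝ] (σ → ℝ)) {H : Type*} {A : H → (𝓢(D, ℂ) →ₗ[ℂ] 𝓢(D, ℂ))}
    {φ : H → σ → ℝ}
    (hA : ∀ (k : H) (p q : σ → ℝ) (f : 𝓢(D, ℂ)), A k (rhoSD e p q f) =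
      rhoSD e (realify (diagHom (torusPt (φ k))) (p, q)).1 (realify (diagHom (torusPt (φ k))) (p, q)).2 (A k f))
    (U : H → ((L2R σ) ≃ₗᵢ[ℂ] L2R σ)) (hU : ∀ k, LiftsTo (opTransport e (A k)) (liftCLM U k)) (k : H)
    (β : σ →₀ ℕ) :
    A k (follandHermite e β) = (vacCoeff U k * torusPhase (φ k) β) • follandHermite e β := by
  have hS : IsRhoCovariantS (fun k => diagHom (torusPt (φ k))) (fun k => opTransport e (A k)) :=
    (isRhoCovariantS_opTransport_iff e _ A).2 hA
  have h1 := hS.apply_hermitePi hU (h := k) (θ := φ k) rfl β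
  rw [opTransport_apply] at h1
  apply (schwartzTransport e).injective
  rw [map_smul, schwartzTransport_follandHermite]
  exact h1

/-- Family form, on all of `𝓢(D)`: `A k = vacCoeff U k • (e^*)⁻¹ ∘ e^{iφ(k)·N} ∘ e^*`. [cite: Folland1989, Prop (4.39)] -/
theorem family_apply_eq_vacCoeff_smul (e : D ≃L[ℝ] (σ → ℝ)) {H : Type*} {A : H → (𝓢(D, ℂ) →ₗ[ℂ] 𝓢(D, ℂ))}
    {φ : H → σ → ℝ}
    (hA : ∀ (k : H) (p q : σ → ℝ) (f : 𝓢(D, ℂ)), A k (rhoSD e p q f) =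
      rhoSD e (realify (diagHom (torusPt (φ k))) (p, q)).1 (realify (diagHom (torusPt (φ k))) (p, q)).2 (A k f))
    (U : H → ((L2R σ) ≃ₗᵢ[ℂ] L2R σ)) (hU : ∀ k, LiftsTo (opTransport e (A k)) (liftCLM U k)) (k : H)
    (f : 𝓢(D, ℂ)) :
    A k f = vacCoeff U k • (schwartzTransport e).symm (torusOpPi (φ k) (schwartzTransport e f)) := by
  have hS : IsRhoCovariantS (fun k => diagHom (torusPt (φ k))) (fun k => opTransport e (A k)) :=
    (isRhoCovariantS_opTransport_iff e _ A).2 hA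
  have h1 := hS.apply_eq_vacCoeff_smul_torusOpPi hU (h := k) (θ := φ k) rfl (schwartzTransport e f)
  simp only [opTransport_apply, ContinuousLinearEquiv.symm_apply_apply] at h1
  apply (schwartzTransport e).injective
  rw [h1, map_smul, ContinuousLinearEquiv.apply_symm_apply]

/-- Family form, the vacuum coefficients are a unitary character when the lifts form a representation:
`‖vacCoeff U k‖ = 1`, and `vacChar` packages `k ↦ vacCoeff U k` as `H →* Circle`. [cite: Folland1989, Prop (4.39)] -/
theorem family_isRhoCovariant_lift (e : D ≃L[ℝ] (σ → ℝ)) {H : Type*} {A : H → (𝓢(D, ℂ) →ₗ[ℂ] 𝓢(D, ℂ))}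
    {φ : H → σ → ℝ}
    (hA : ∀ (k : H) (p q : σ → ℝ) (f : 𝓢(D, ℂ)), A k (rhoSD e p q f) =
      rhoSD e (realify (diagHom (torusPt (φ k))) (p, q)).1 (realify (diagHom (torusPt (φ k))) (p, q)).2 (A k f))
    (U : H → ((L2R σ) ≃ₗᵢ[ℂ] L2R σ)) (hU : ∀ k, LiftsTo (opTransport e (A k)) (liftCLM U k)) :
    IsRhoCovariant (fun k => diagHom (torusPt (φ k))) U :=
  ((isRhoCovariantS_opTransport_iff e _ A).2 hA).lift hU

end Generic

/-! ## §2 The archimedean tensor factor of a torus implementer, in the adapted Folland frame -/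

section Arch

variable {F : Type} [Field F] [NumberField F] [IsTotallyReal F] {ι : Type} [Fintype ι] [DecidableEq ι]

local notation "L2R" σ => Lp ℂ 2 (volume : Measure (σ → ℝ))

/-- **Exact torus covariance of the archimedean factor.**  In the setting of STEP 2 (`archPhaseMap_torus`: `F`
totally real, `T = diag(t₀) ⊗ 1`, purely imaginary quadratic coordinates at the real places, adapted scaling
`im δ'_v · D_{j,v}² = ε_{j,v} σ_v(t₀ j)`, `ε = ±1`, and `g ∈ Sp(W_𝔸)` acting on archimedean pairs place by place as the
torus `diag(e^{iθ_{·,v}})` — hypothesis `hg`), the archimedean tensor factor `A` of ANY implementer `M = A ⊗ M_f` of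
`g` on the adelic Schwartz–Bruhat space is EXACTLY `rhoSD e_D`-covariant over the rotation
`realify (diagHom (torusPt (ε · θ)))`, `e_D = scaledFrame D` (LEAF C `arch_covariant_rhoSD_exact`: the Folland
cocycle is `1`). [cite: Folland1989, Prop. (1.43); Ch. 4 §1 Prop. (4.6)] -/
theorem arch_torus_covariant_rhoSD (t₀ : ι → F) {T : Matrix ι ι (AdeleRing (𝓞 F) F)}
    (hT : T = (Matrix.diagonal t₀).map (algebraMap F (AdeleRing (𝓞 F) F))) (hTu : IsUnit (archMat F ι T))
    {Ψ : {v : InfinitePlace F // v.IsReal} → ((ℝ × ℝ) ≃+ ℂ)} {δ' : {v : InfinitePlace F // v.IsReal} → ℂ} {d : {v : InfinitePlace F // v.IsReal} → ℝ}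
    (hq : ∀ v, IsQuadraticCoordinates Complex.ofRealHom (Ψ v) (δ' v) (d v)) (hre : ∀ v, (δ' v).re = 0)
    {D ε : ι × {v : InfinitePlace F // v.IsReal} → ℝ} (hD0 : ∀ k, D k ≠ 0)
    (hD : ∀ k, (δ' k.2).im * D k ^ 2 = ε k * embedding_of_isReal k.2.2 (t₀ k.1))
    (hε : ∀ k, ε k = 1 ∨ ε k = -1)
    (g : symplecticGroup (polar (adelicForm F ι T))) (θ : ι × {v : InfinitePlace F // v.IsReal} → ℝ)
    (hg : ∀ (a w : ι → mixedSpace F) (v : {v : InfinitePlace F // v.IsReal}),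
      (placeVec F ι v (archAct T g (a, w)).1, placeVec F ι v (archAct T g (a, w)).2) =
        (hq v).resAut ι (torusGL fun j => θ (j, v)) (placeVec F ι v a, placeVec F ι v w))
    (M : piSchwartzBruhat F ι ≃ₗ[ℂ] piSchwartzBruhat F ι)
    (hM : Implements (adelicSchrodinger F ι T) (ofSymplectic (polar (adelicForm F ι T)) g) M)
    (A : 𝓢((ι → mixedSpace F), ℂ) →ₗ[ℂ] 𝓢((ι → mixedSpace F), ℂ)) (Mf : FinSB F ι →ₗ[ℂ] FinSB F ι)
    (hAM : ∀ (Φ : 𝓢((ι → mixedSpace F), ℂ)) (f : FinSB F ι),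
      M (piSchwartzBruhatEquiv F ι (Φ ⊗ₜ f)) = piSchwartzBruhatEquiv F ι (A Φ ⊗ₜ Mf f))
    {f₀ : FinSB F ι} (hf₀ : Mf f₀ ≠ 0) (p q : ι × {v : InfinitePlace F // v.IsReal} → ℝ) (Φ : 𝓢((ι → mixedSpace F), ℂ)) :
    A (rhoSD (scaledFrame F ι D hD0) p q Φ) =
      rhoSD (scaledFrame F ι D hD0) (realify (diagHom (torusPt fun k => ε k * θ k)) (p, q)).1
        (realify (diagHom (torusPt fun k => ε k * θ k)) (p, q)).2 (A Φ) := by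
  have h := arch_covariant_rhoSD_exact T (scaledFrame F ι D hD0) hTu g M hM A Mf hAM hf₀ p q Φ
  rwa [archPhaseMap_torus t₀ hT hTu hq hre hD0 hD hε g θ hg] at h

/-- **STEP 3, main statement: the archimedean factor of a torus implementer IS `e^{i(ε·θ)·N}` in the adapted
Folland frame, up to its vacuum coefficient.**  Under the hypotheses of `arch_torus_covariant_rhoSD`, if the
transport `e_D^* A (e_D^*)⁻¹` of the archimedean factor is the restriction of a unitary operator `U` of `L²(ℝ^σ)`
(`σ = ι × {real places}`), then for EVERY archimedean Schwartz function `Φ`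
`A Φ = ⟪k₀, U k₀⟫ · (e_D^*)⁻¹ (e^{i(ε·θ)·N} (e_D^* Φ))`. [cite: Folland1989, Prop (4.39); Ch. 4 §1 Prop. (4.6)] -/
theorem arch_torus_apply_eq_vacCoeffU_smul (t₀ : ι → F) {T : Matrix ι ι (AdeleRing (𝓞 F) F)}
    (hT : T = (Matrix.diagonal t₀).map (algebraMap F (AdeleRing (𝓞 F) F))) (hTu : IsUnit (archMat F ι T))
    {Ψ : {v : InfinitePlace F // v.IsReal} → ((ℝ × ℝ) ≃+ ℂ)} {δ' : {v : InfinitePlace F // v.IsReal} → ℂ} {d : {v : InfinitePlace F // v.IsReal} → ℝ}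
    (hq : ∀ v, IsQuadraticCoordinates Complex.ofRealHom (Ψ v) (δ' v) (d v)) (hre : ∀ v, (δ' v).re = 0)
    {D ε : ι × {v : InfinitePlace F // v.IsReal} → ℝ} (hD0 : ∀ k, D k ≠ 0)
    (hD : ∀ k, (δ' k.2).im * D k ^ 2 = ε k * embedding_of_isReal k.2.2 (t₀ k.1))
    (hε : ∀ k, ε k = 1 ∨ ε k = -1)
    (g : symplecticGroup (polar (adelicForm F ι T))) (θ : ι × {v : InfinitePlace F // v.IsReal} → ℝ)
    (hg : ∀ (a w : ι → mixedSpace F) (v : {v : InfinitePlace F // v.IsReal}),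
      (placeVec F ι v (archAct T g (a, w)).1, placeVec F ι v (archAct T g (a, w)).2) =
        (hq v).resAut ι (torusGL fun j => θ (j, v)) (placeVec F ι v a, placeVec F ι v w))
    (M : piSchwartzBruhat F ι ≃ₗ[ℂ] piSchwartzBruhat F ι)
    (hM : Implements (adelicSchrodinger F ι T) (ofSymplectic (polar (adelicForm F ι T)) g) M)
    (A : 𝓢((ι → mixedSpace F), ℂ) →ₗ[ℂ] 𝓢((ι → mixedSpace F), ℂ)) (Mf : FinSB F ι →ₗ[ℂ] FinSB F ι)
    (hAM : ∀ (Φ : 𝓢((ι → mixedSpace F), ℂ)) (f : FinSB F ι),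
      M (piSchwartzBruhatEquiv F ι (Φ ⊗ₜ f)) = piSchwartzBruhatEquiv F ι (A Φ ⊗ₜ Mf f))
    {f₀ : FinSB F ι} (hf₀ : Mf f₀ ≠ 0)
    (U : (L2R (ι × {v : InfinitePlace F // v.IsReal})) ≃ₗᵢ[ℂ] L2R (ι × {v : InfinitePlace F // v.IsReal}))
    (hU : LiftsTo (opTransport (scaledFrame F ι D hD0) A)
      ((U.toContinuousLinearEquiv : (L2R (ι × {v : InfinitePlace F // v.IsReal})) ≃L[ℂ] L2R (ι × {v : InfinitePlace F // v.IsReal})) :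
        (L2R (ι × {v : InfinitePlace F // v.IsReal})) →L[ℂ] L2R (ι × {v : InfinitePlace F // v.IsReal})))
    (Φ : 𝓢((ι → mixedSpace F), ℂ)) :
    A Φ = vacCoeffU U • (schwartzTransport (scaledFrame F ι D hD0)).symm
      (torusOpPi (fun k => ε k * θ k) (schwartzTransport (scaledFrame F ι D hD0) Φ)) :=
  apply_eq_vacCoeffU_smul_of_torusCovariant (scaledFrame F ι D hD0)
    (arch_torus_covariant_rhoSD t₀ hT hTu hq hre hD0 hD hε g θ hg M hM A Mf hAM hf₀) U hU Φ

/-- … the vacuum coefficient is unimodular. [cite: Folland1989, Prop (4.39)] -/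
theorem arch_torus_norm_vacCoeffU (t₀ : ι → F) {T : Matrix ι ι (AdeleRing (𝓞 F) F)}
    (hT : T = (Matrix.diagonal t₀).map (algebraMap F (AdeleRing (𝓞 F) F))) (hTu : IsUnit (archMat F ι T))
    {Ψ : {v : InfinitePlace F // v.IsReal} → ((ℝ × ℝ) ≃+ ℂ)} {δ' : {v : InfinitePlace F // v.IsReal} → ℂ} {d : {v : InfinitePlace F // v.IsReal} → ℝ}
    (hq : ∀ v, IsQuadraticCoordinates Complex.ofRealHom (Ψ v) (δ' v) (d v)) (hre : ∀ v, (δ' v).re = 0)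
    {D ε : ι × {v : InfinitePlace F // v.IsReal} → ℝ} (hD0 : ∀ k, D k ≠ 0)
    (hD : ∀ k, (δ' k.2).im * D k ^ 2 = ε k * embedding_of_isReal k.2.2 (t₀ k.1))
    (hε : ∀ k, ε k = 1 ∨ ε k = -1)
    (g : symplecticGroup (polar (adelicForm F ι T))) (θ : ι × {v : InfinitePlace F // v.IsReal} → ℝ)
    (hg : ∀ (a w : ι → mixedSpace F) (v : {v : InfinitePlace F // v.IsReal}),
      (placeVec F ι v (archAct T g (a, w)).1, placeVec F ι v (archAct T g (a, w)).2) =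
        (hq v).resAut ι (torusGL fun j => θ (j, v)) (placeVec F ι v a, placeVec F ι v w))
    (M : piSchwartzBruhat F ι ≃ₗ[ℂ] piSchwartzBruhat F ι)
    (hM : Implements (adelicSchrodinger F ι T) (ofSymplectic (polar (adelicForm F ι T)) g) M)
    (A : 𝓢((ι → mixedSpace F), ℂ) →ₗ[ℂ] 𝓢((ι → mixedSpace F), ℂ)) (Mf : FinSB F ι →ₗ[ℂ] FinSB F ι)
    (hAM : ∀ (Φ : 𝓢((ι → mixedSpace F), ℂ)) (f : FinSB F ι),
      M (piSchwartzBruhatEquiv F ι (Φ ⊗ₜ f)) = piSchwartzBruhatEquiv F ι (A Φ ⊗ₜ Mf f))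
    {f₀ : FinSB F ι} (hf₀ : Mf f₀ ≠ 0)
    (U : (L2R (ι × {v : InfinitePlace F // v.IsReal})) ≃ₗᵢ[ℂ] L2R (ι × {v : InfinitePlace F // v.IsReal}))
    (hU : LiftsTo (opTransport (scaledFrame F ι D hD0) A)
      ((U.toContinuousLinearEquiv : (L2R (ι × {v : InfinitePlace F // v.IsReal})) ≃L[ℂ] L2R (ι × {v : InfinitePlace F // v.IsReal})) :
        (L2R (ι × {v : InfinitePlace F // v.IsReal})) →L[ℂ] L2R (ι × {v : InfinitePlace F // v.IsReal}))) :
    ‖vacCoeffU U‖ = 1 :=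
  norm_vacCoeffU_of_torusCovariant (scaledFrame F ι D hD0)
    (arch_torus_covariant_rhoSD t₀ hT hTu hq hre hD0 hD hε g θ hg M hM A Mf hAM hf₀) U hU

/-- **STEP 3 on the Hermite functions: the Hermite functions of the ADAPTED Folland frame are weight vectors of
every archimedean torus implementer**, with torus weight the SIGNED index `ε · β` (STEP 1's sign vector
`ε_{j,v}`; the opposite sign is refused by the kernel, `ArchFollandTorus`) times the vacuum coefficient:
`A (follandHermite e_D β) = (⟪k₀, U k₀⟫ · e^{i Σ_k ε_k θ_k β_k}) • follandHermite e_D β`.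
[cite: Folland1989, §1.7, Prop (4.39); Ch. 4 §1 Prop. (4.6)] -/
theorem arch_torus_apply_follandHermite (t₀ : ι → F) {T : Matrix ι ι (AdeleRing (𝓞 F) F)}
    (hT : T = (Matrix.diagonal t₀).map (algebraMap F (AdeleRing (𝓞 F) F))) (hTu : IsUnit (archMat F ι T))
    {Ψ : {v : InfinitePlace F // v.IsReal} → ((ℝ × ℝ) ≃+ ℂ)} {δ' : {v : InfinitePlace F // v.IsReal} → ℂ} {d : {v : InfinitePlace F // v.IsReal} → ℝ}
    (hq : ∀ v, IsQuadraticCoordinates Complex.ofRealHom (Ψ v) (δ' v) (d v)) (hre : ∀ v, (δ' v).re = 0)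
    {D ε : ι × {v : InfinitePlace F // v.IsReal} → ℝ} (hD0 : ∀ k, D k ≠ 0)
    (hD : ∀ k, (δ' k.2).im * D k ^ 2 = ε k * embedding_of_isReal k.2.2 (t₀ k.1))
    (hε : ∀ k, ε k = 1 ∨ ε k = -1)
    (g : symplecticGroup (polar (adelicForm F ι T))) (θ : ι × {v : InfinitePlace F // v.IsReal} → ℝ)
    (hg : ∀ (a w : ι → mixedSpace F) (v : {v : InfinitePlace F // v.IsReal}),
      (placeVec F ι v (archAct T g (a, w)).1, placeVec F ι v (archAct T g (a, w)).2) =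
        (hq v).resAut ι (torusGL fun j => θ (j, v)) (placeVec F ι v a, placeVec F ι v w))
    (M : piSchwartzBruhat F ι ≃ₗ[ℂ] piSchwartzBruhat F ι)
    (hM : Implements (adelicSchrodinger F ι T) (ofSymplectic (polar (adelicForm F ι T)) g) M)
    (A : 𝓢((ι → mixedSpace F), ℂ) →ₗ[ℂ] 𝓢((ι → mixedSpace F), ℂ)) (Mf : FinSB F ι →ₗ[ℂ] FinSB F ι)
    (hAM : ∀ (Φ : 𝓢((ι → mixedSpace F), ℂ)) (f : FinSB F ι),
      M (piSchwartzBruhatEquiv F ι (Φ ⊗ₜ f)) = piSchwartzBruhatEquiv F ι (A Φ ⊗ₜ Mf f))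
    {f₀ : FinSB F ι} (hf₀ : Mf f₀ ≠ 0)
    (U : (L2R (ι × {v : InfinitePlace F // v.IsReal})) ≃ₗᵢ[ℂ] L2R (ι × {v : InfinitePlace F // v.IsReal}))
    (hU : LiftsTo (opTransport (scaledFrame F ι D hD0) A)
      ((U.toContinuousLinearEquiv : (L2R (ι × {v : InfinitePlace F // v.IsReal})) ≃L[ℂ] L2R (ι × {v : InfinitePlace F // v.IsReal})) :
        (L2R (ι × {v : InfinitePlace F // v.IsReal})) →L[ℂ] L2R (ι × {v : InfinitePlace F // v.IsReal})))
    (β : ι × {v : InfinitePlace F // v.IsReal} →₀ ℕ) :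
    A (follandHermite (scaledFrame F ι D hD0) β) =
      (vacCoeffU U * torusPhase (fun k => ε k * θ k) β) • follandHermite (scaledFrame F ι D hD0) β :=
  apply_follandHermite_of_torusCovariant (scaledFrame F ι D hD0)
    (arch_torus_covariant_rhoSD t₀ hT hTu hq hre hD0 hD hε g θ hg M hM A Mf hAM hf₀) U hU β

omit [IsTotallyReal F] [DecidableEq ι] in
/-- **The weight, spelled out**: `torusPhase (ε · θ) β = exp(i Σ_{(j,v)} ε_{j,v} θ_{j,v} β_{j,v})` — for the
POSITIVE directions (`ε = +1`, i.e. `im δ'_v · σ_v(t₀ j) > 0`) the Hermite degree enters with `+θ`, for the negative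
ones with `−θ`. [cite: Folland1989, §1.7] -/
theorem torusPhase_signed (ε θ : ι × {v : InfinitePlace F // v.IsReal} → ℝ)
    (β : ι × {v : InfinitePlace F // v.IsReal} →₀ ℕ) :
    torusPhase (fun k => ε k * θ k) β =
      cexp (((∑ k : ι × {v : InfinitePlace F // v.IsReal}, ε k * θ k * (β k : ℝ) : ℝ) : ℂ) * I) := rfl

/-- **Canonical adapted scaling** (`D_{j,v} = √(|σ_v(t₀ j)| / |im δ'_v|)`, `ε_{j,v} = sgn(im δ'_v · σ_v(t₀ j))`):
the weight of `follandHermite e_D β` is `⟪k₀, U k₀⟫ · exp(i Σ sgn(im δ'_v σ_v(t₀ j)) θ_{j,v} β_{j,v})`.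
[cite: Folland1989, §1.7, Prop (4.39); Ch. 4 §1 Prop. (4.6)] -/
theorem arch_torus_apply_follandHermite_sqrt (t₀ : ι → F) (ht₀ : ∀ j, t₀ j ≠ 0) {T : Matrix ι ι (AdeleRing (𝓞 F) F)}
    (hT : T = (Matrix.diagonal t₀).map (algebraMap F (AdeleRing (𝓞 F) F))) (hTu : IsUnit (archMat F ι T))
    {Ψ : {v : InfinitePlace F // v.IsReal} → ((ℝ × ℝ) ≃+ ℂ)} {δ' : {v : InfinitePlace F // v.IsReal} → ℂ} {d : {v : InfinitePlace F // v.IsReal} → ℝ}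
    (hq : ∀ v, IsQuadraticCoordinates Complex.ofRealHom (Ψ v) (δ' v) (d v)) (hre : ∀ v, (δ' v).re = 0)
    (g : symplecticGroup (polar (adelicForm F ι T))) (θ : ι × {v : InfinitePlace F // v.IsReal} → ℝ)
    (hg : ∀ (a w : ι → mixedSpace F) (v : {v : InfinitePlace F // v.IsReal}),
      (placeVec F ι v (archAct T g (a, w)).1, placeVec F ι v (archAct T g (a, w)).2) =
        (hq v).resAut ι (torusGL fun j => θ (j, v)) (placeVec F ι v a, placeVec F ι v w))
    (M : piSchwartzBruhat F ι ≃ₗ[ℂ] piSchwartzBruhat F ι)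
    (hM : Implements (adelicSchrodinger F ι T) (ofSymplectic (polar (adelicForm F ι T)) g) M)
    (A : 𝓢((ι → mixedSpace F), ℂ) →ₗ[ℂ] 𝓢((ι → mixedSpace F), ℂ)) (Mf : FinSB F ι →ₗ[ℂ] FinSB F ι)
    (hAM : ∀ (Φ : 𝓢((ι → mixedSpace F), ℂ)) (f : FinSB F ι),
      M (piSchwartzBruhatEquiv F ι (Φ ⊗ₜ f)) = piSchwartzBruhatEquiv F ι (A Φ ⊗ₜ Mf f))
    {f₀ : FinSB F ι} (hf₀ : Mf f₀ ≠ 0)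
    (U : (L2R (ι × {v : InfinitePlace F // v.IsReal})) ≃ₗᵢ[ℂ] L2R (ι × {v : InfinitePlace F // v.IsReal}))
    (hU : LiftsTo (opTransport (scaledFrame F ι
        (fun k => Real.sqrt (|embedding_of_isReal k.2.2 (t₀ k.1)| / |(δ' k.2).im|)) (sqrt_scale_ne_zero t₀ ht₀ hq hre)) A)
      ((U.toContinuousLinearEquiv : (L2R (ι × {v : InfinitePlace F // v.IsReal})) ≃L[ℂ] L2R (ι × {v : InfinitePlace F // v.IsReal})) :
        (L2R (ι × {v : InfinitePlace F // v.IsReal})) →L[ℂ] L2R (ι × {v : InfinitePlace F // v.IsReal})))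
    (β : ι × {v : InfinitePlace F // v.IsReal} →₀ ℕ) :
    A (follandHermite (scaledFrame F ι
        (fun k => Real.sqrt (|embedding_of_isReal k.2.2 (t₀ k.1)| / |(δ' k.2).im|)) (sqrt_scale_ne_zero t₀ ht₀ hq hre)) β) =
      (vacCoeffU U * torusPhase (fun k =>
          (SignType.sign ((δ' k.2).im * embedding_of_isReal k.2.2 (t₀ k.1)) : ℝ) * θ k) β) •
        follandHermite (scaledFrame F ι
          (fun k => Real.sqrt (|embedding_of_isReal k.2.2 (t₀ k.1)| / |(δ' k.2).im|)) (sqrt_scale_ne_zero t₀ ht₀ hq hre)) β :=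
  arch_torus_apply_follandHermite t₀ hT hTu hq hre (sqrt_scale_ne_zero t₀ ht₀ hq hre)
    (fun k => adapted_sqrt (im_ne_zero_of_isQuadraticCoordinates (hq k.2) (hre k.2))
      (fun j => embedding_of_isReal k.2.2 (t₀ j)) k.1)
    (fun k => sign_eq_one_or (im_ne_zero_of_isQuadraticCoordinates (hq k.2) (hre k.2))
      (fun j => (map_ne_zero_iff _ (embedding_of_isReal k.2.2).injective).mpr (ht₀ j)) k.1)
    g θ hg M hM A Mf hAM hf₀ U hU β

end Arch

/-! ## §3 In the currency of a CM-type quadratic extension `E/F` (`archLocalToSymplectic` at the place over `v`) -/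

section CM

variable {F : Type} [Field F] [NumberField F] [IsTotallyReal F]
variable (E : Type) [Field E] [NumberField E] [Algebra F E] (c : E ≃ₐ[F] E) (N : ℕ)

local notation "L2R" σ => Lp ℂ 2 (volume : Measure (σ → ℝ))

/-- **STEP 2 in `archLocalToSymplectic` currency, as a phase-space map**: with the data of
`archFolland_archAct_archLocalTorus` (`wOf v` a complex place of `E` over the real place `v` of `F` fixed by `c ≠ 1`,
`c δ = −δ ≠ 0`, `J = diag(t₀) ⊗ 1`, `t₀ j ≠ 0`, `g` acting place by place as `archLocalToSymplectic (wOf v) ⟨torusGL θ_v, _⟩`),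
`archPhaseMap T e_D hTu g = realify (diagHom (torusPt (ε · θ)))` in the canonically scaled frame, with
`ε_{j,v} = sgn(im σ_{w(v)}(δ) · σ_{w(v)}(t₀ j))`. [cite: Folland1989, Ch. 4 §1, Prop. (4.6) p. 151] -/
theorem archPhaseMap_archLocalTorus {δ : E} (hcδ : c δ = -δ) (hδ : δ ≠ 0) (hc : c ≠ 1)
    (wOf : {v : InfinitePlace F // v.IsReal} → {w : InfinitePlace E // w.IsComplex})
    (hw : ∀ v, c • (wOf v).1 = (wOf v).1) (hover : ∀ v, (wOf v).1.comap (algebraMap F E) = v.1)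
    (t₀ : Fin N → F) (ht₀ : ∀ j, t₀ j ≠ 0) (hTs : (Matrix.diagonal t₀).IsSymm)
    {J : Matrix (Fin N) (Fin N) E} (hJ : J = (Matrix.diagonal t₀).map (algebraMap F E))
    {T : Matrix (Fin N) (Fin N) (AdeleRing (𝓞 F) F)}
    (hT : T = (Matrix.diagonal t₀).map (algebraMap F (AdeleRing (𝓞 F) F))) (hTu : IsUnit (archMat F (Fin N) T))
    (g : symplecticGroup (polar (adelicForm F (Fin N) T)))
    (θ : Fin N × {v : InfinitePlace F // v.IsReal} → ℝ)
    (hmem : ∀ v, torusGL (fun j => θ (j, v)) ∈ UnitaryGroup.archLocal E N J (wOf v))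
    (hg : ∀ (a w : Fin N → mixedSpace F) (v : {v : InfinitePlace F // v.IsReal}),
      (placeVec F (Fin N) v (archAct T g (a, w)).1, placeVec F (Fin N) v (archAct T g (a, w)).2) =
        (UnitaryGroup.archLocalToSymplectic F E c N (wOf v) (hw v) hc hcδ hδ hTs hJ
          ⟨torusGL fun j => θ (j, v), hmem v⟩).1 (placeVec F (Fin N) v a, placeVec F (Fin N) v w)) :
    archPhaseMap T (scaledFrame F (Fin N)
        (fun k => Real.sqrt (|UnitaryGroup.realPlaceMap F E c (wOf k.2) (hw k.2) hc (t₀ k.1)| /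
          |((wOf k.2).1.embedding δ).im|)) (sqrt_scale_ne_zero_CM E c N hcδ hδ hc wOf hw t₀ ht₀)) hTu g =
      realify (diagHom (torusPt fun k =>
          (SignType.sign (((wOf k.2).1.embedding δ).im *
            UnitaryGroup.realPlaceMap F E c (wOf k.2) (hw k.2) hc (t₀ k.1)) : ℝ) * θ k)) := by
  funext pq
  obtain ⟨⟨a, w⟩, rfl⟩ := (archFolland_bijective (T := T) (scaledFrame F (Fin N)
    (fun k => Real.sqrt (|UnitaryGroup.realPlaceMap F E c (wOf k.2) (hw k.2) hc (t₀ k.1)| /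
      |((wOf k.2).1.embedding δ).im|)) (sqrt_scale_ne_zero_CM E c N hcδ hδ hc wOf hw t₀ ht₀)) hTu).2 pq
  rw [archPhaseMap_archFolland]
  exact archFolland_archAct_archLocalTorus E c N hcδ hδ hc wOf hw hover t₀ ht₀ hTs hJ hT g θ hmem hg _ a w

/-- **STEP 3 in CM currency: the Hermite functions of the canonically scaled Folland frame are weight vectors of
every archimedean implementer of the compact diagonal torus `diag(e^{iθ_{j,v}}) ∈ U(J)(E_{w(v)})`, with weight
`⟪k₀, U k₀⟫ · exp(i Σ_{j,v} sgn(im σ_{w(v)}(δ) · σ_{w(v)}(t₀ j)) θ_{j,v} β_{j,v})`.**  The sign attached to the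
Hermite degree in the `(j, v)` direction is `+` exactly when `im σ_{w(v)}(δ) · σ_{w(v)}(t₀ j) > 0`.
[cite: Folland1989, §1.7, Prop (4.39); Ch. 4 §1 Prop. (4.6)] -/
theorem archCM_torus_apply_follandHermite {δ : E} (hcδ : c δ = -δ) (hδ : δ ≠ 0) (hc : c ≠ 1)
    (wOf : {v : InfinitePlace F // v.IsReal} → {w : InfinitePlace E // w.IsComplex})
    (hw : ∀ v, c • (wOf v).1 = (wOf v).1) (hover : ∀ v, (wOf v).1.comap (algebraMap F E) = v.1)
    (t₀ : Fin N → F) (ht₀ : ∀ j, t₀ j ≠ 0) (hTs : (Matrix.diagonal t₀).IsSymm)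
    {J : Matrix (Fin N) (Fin N) E} (hJ : J = (Matrix.diagonal t₀).map (algebraMap F E))
    {T : Matrix (Fin N) (Fin N) (AdeleRing (𝓞 F) F)}
    (hT : T = (Matrix.diagonal t₀).map (algebraMap F (AdeleRing (𝓞 F) F))) (hTu : IsUnit (archMat F (Fin N) T))
    (g : symplecticGroup (polar (adelicForm F (Fin N) T)))
    (θ : Fin N × {v : InfinitePlace F // v.IsReal} → ℝ)
    (hmem : ∀ v, torusGL (fun j => θ (j, v)) ∈ UnitaryGroup.archLocal E N J (wOf v))
    (hg : ∀ (a w : Fin N → mixedSpace F) (v : {v : InfinitePlace F // v.IsReal}),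
      (placeVec F (Fin N) v (archAct T g (a, w)).1, placeVec F (Fin N) v (archAct T g (a, w)).2) =
        (UnitaryGroup.archLocalToSymplectic F E c N (wOf v) (hw v) hc hcδ hδ hTs hJ
          ⟨torusGL fun j => θ (j, v), hmem v⟩).1 (placeVec F (Fin N) v a, placeVec F (Fin N) v w))
    (M : piSchwartzBruhat F (Fin N) ≃ₗ[ℂ] piSchwartzBruhat F (Fin N))
    (hM : Implements (adelicSchrodinger F (Fin N) T) (ofSymplectic (polar (adelicForm F (Fin N) T)) g) M)
    (A : 𝓢((Fin N → mixedSpace F), ℂ) →ₗ[ℂ] 𝓢((Fin N → mixedSpace F), ℂ)) (Mf : FinSB F (Fin N) →ₗ[ℂ] FinSB F (Fin N))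
    (hAM : ∀ (Φ : 𝓢((Fin N → mixedSpace F), ℂ)) (f : FinSB F (Fin N)),
      M (piSchwartzBruhatEquiv F (Fin N) (Φ ⊗ₜ f)) = piSchwartzBruhatEquiv F (Fin N) (A Φ ⊗ₜ Mf f))
    {f₀ : FinSB F (Fin N)} (hf₀ : Mf f₀ ≠ 0)
    (U : (L2R (Fin N × {v : InfinitePlace F // v.IsReal})) ≃ₗᵢ[ℂ] L2R (Fin N × {v : InfinitePlace F // v.IsReal}))
    (hU : LiftsTo (opTransport (scaledFrame F (Fin N)
        (fun k => Real.sqrt (|UnitaryGroup.realPlaceMap F E c (wOf k.2) (hw k.2) hc (t₀ k.1)| /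
          |((wOf k.2).1.embedding δ).im|)) (sqrt_scale_ne_zero_CM E c N hcδ hδ hc wOf hw t₀ ht₀)) A)
      ((U.toContinuousLinearEquiv : (L2R (Fin N × {v : InfinitePlace F // v.IsReal})) ≃L[ℂ]
          L2R (Fin N × {v : InfinitePlace F // v.IsReal})) :
        (L2R (Fin N × {v : InfinitePlace F // v.IsReal})) →L[ℂ] L2R (Fin N × {v : InfinitePlace F // v.IsReal})))
    (β : Fin N × {v : InfinitePlace F // v.IsReal} →₀ ℕ) :
    A (follandHermite (scaledFrame F (Fin N)
        (fun k => Real.sqrt (|UnitaryGroup.realPlaceMap F E c (wOf k.2) (hw k.2) hc (t₀ k.1)| /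
          |((wOf k.2).1.embedding δ).im|)) (sqrt_scale_ne_zero_CM E c N hcδ hδ hc wOf hw t₀ ht₀)) β) =
      (vacCoeffU U * torusPhase (fun k =>
          (SignType.sign (((wOf k.2).1.embedding δ).im *
            UnitaryGroup.realPlaceMap F E c (wOf k.2) (hw k.2) hc (t₀ k.1)) : ℝ) * θ k) β) •
        follandHermite (scaledFrame F (Fin N)
          (fun k => Real.sqrt (|UnitaryGroup.realPlaceMap F E c (wOf k.2) (hw k.2) hc (t₀ k.1)| /
            |((wOf k.2).1.embedding δ).im|)) (sqrt_scale_ne_zero_CM E c N hcδ hδ hc wOf hw t₀ ht₀)) β := by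
  refine apply_follandHermite_of_torusCovariant _ (fun p q Φ => ?_) U hU β
  have h := arch_covariant_rhoSD_exact T (scaledFrame F (Fin N)
    (fun k => Real.sqrt (|UnitaryGroup.realPlaceMap F E c (wOf k.2) (hw k.2) hc (t₀ k.1)| /
      |((wOf k.2).1.embedding δ).im|)) (sqrt_scale_ne_zero_CM E c N hcδ hδ hc wOf hw t₀ ht₀)) hTu g M hM A Mf hAM hf₀ p q Φ
  rwa [archPhaseMap_archLocalTorus E c N hcδ hδ hc wOf hw hover t₀ ht₀ hTs hJ hT hTu g θ hmem hg] at h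

end CM

end Literature.NumberTheory.Weil1964

end
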